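import Summits.AtomisticToContinuum.HydrodynamicLimit.Theorems.MourreKoopmanChargesLinearToEntropyInBandDefs
import Literature.Analysis.FluidPDE.HardSphereCollisionRecord
import HarnessLib

/-!
# STUB-1 GAP (scratch, lead c5, NOT landed): the collisional-transfer rows of visible flux-Gibbsianity are not
# covered by the crux's two kinetic hypotheses — the missing input TYPED

`VisibleFluxGibbsianity` (Defs §2) controls the window pressure of `X_vis = τ⁻¹[∫ kin + Σ_coll coll − ∫ flux]`.
Its `L²` (second-cumulant) shadow needs, besides the kinetic rows (covered: `stub_windowVarianceGalilean`, p163084, from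
`OneBodyCompleteness`), that the WINDOW VARIANCE of the tested COLLISIONAL momentum / energy transfer under the
homogeneous equilibrium law be `o(N+1)` as the window `S → ∞` (in mean-free-time units) AFTER `N → ∞` — a zero
collisional Drude weight.  Neither `OneBodyCompleteness` (one-body fields `χ(x)h(v)`) nor `StressStrongMixing` (kinetic
shear stress) speaks about the two-body collision functional, and the Helfand identity
`d/dt Σᵢ φ(xᵢ)vᵢ = (kinetic tested stress) + (collisional tested transfer)` is useless on the micro-window
`w = S(N+1)^{-1/3}`: its boundary term has variance `≍ (N+1)θ‖φ‖²/w²`, i.e. `(N+1)^{5/3}/S²` — not `o(N+1)`.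
The two statements below are the candidate THIRD hypothesis of the crux (route repair), typed in the shell of
`OneBodyCompleteness` (equilibrium law `localGibbsLaw σ 1 0 θ`, window `S (N+1)^{-1/3}`, `∃ S₀ ∀ S ≥ S₀ ∃ N₀ ∀ N ≥ N₀`) and in the
record vocabulary of `LocalClampedTransferWindowLDFamily` (`HardSphereFlow.collisionSum`, mark `(φ(x₁) − φ(x₂))·Δ/2`); `∫⁻ ∘ ofReal`
so that a non-integrable square is not a freebie.  Mean zero is automatic on the torus (`∫ ∂ₖφ = 0`).
-/

noncomputable section

open MeasureTheory Set
open scoped ENNReal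

namespace Summit.AtomisticToContinuum.HydrodynamicLimit.Theorems.LTEInBand.Stub1Gap

open Literature.MathematicalPhysics.KineticTheory Literature.Analysis.FluidPDE Literature.Analysis.FunctionSpaces

/-- **Collisional momentum-transfer completeness (zero collisional Drude weight, window-variance form).**  For reduced
diameters `σ < σ₀`, every temperature, every flow family, every smooth `φ : 𝕋³ → ℝ`, every component `k` and `δ > 0`:
for `S ≥ S₀(δ)` and `N ≥ N₀(S)`,
`E_eq[(w⁻¹ · Σ_{collisions c, c.time ∈ (0, w]} (φ(c.fstPos) − φ(c.sndPos)) (c.postVel.1 k − c.preVel.1 k)/2)²] ≤ δ (N+1)`,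
`w = S (N+1)^{-1/3}`.  Heuristic size without long-time correlations: `(N+1) σ⁴/S` (independent collisions), so the content
is exactly the absence of ballistic collisional momentum transport over `S` mean free times. -/
def CollisionalMomentumTransferCompleteness : Prop :=
  ∃ σ₀ : ℝ, 0 < σ₀ ∧ ∀ σ : ℝ, 0 < σ → σ < σ₀ → ∀ θ : ℝ, 0 < θ →
    ∀ Φ : (N : ℕ) → HardSphereFlow (Torus.geometry (Fin 3)) (hsDiameter σ N) (N + 1),
    ∀ φ : T3 → ℝ, Torus.IsSmooth φ → ∀ k : Fin 3, ∀ δ : ℝ, 0 < δ →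
    ∃ S₀ : ℝ, 0 < S₀ ∧ ∀ S : ℝ, S₀ ≤ S → ∃ N₀ : ℕ, ∀ N : ℕ, N₀ ≤ N →
      ∫⁻ z, ENNReal.ofReal (((S * ((N : ℝ) + 1) ^ (-(1 / 3 : ℝ)))⁻¹ *
          (Φ N).collisionSum (Set.Ioc 0 (S * ((N : ℝ) + 1) ^ (-(1 / 3 : ℝ))))
            (fun c => (φ c.fstPos - φ c.sndPos) * (c.postVel.1 k - c.preVel.1 k) / 2) z) ^ 2)
        ∂(localGibbsLaw σ (fun _ => 1) (fun _ => 0) (fun _ => θ) N (Φ N)) ≤ ENNReal.ofReal (δ * ((N : ℝ) + 1))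

/-- **Collisional energy-transfer completeness** — the same with the energy mark
`(φ(c.fstPos) − φ(c.sndPos)) (‖c.postVel.1‖² − ‖c.preVel.1‖²)/4` (collisional heat flux). -/
def CollisionalEnergyTransferCompleteness : Prop :=
  ∃ σ₀ : ℝ, 0 < σ₀ ∧ ∀ σ : ℝ, 0 < σ → σ < σ₀ → ∀ θ : ℝ, 0 < θ →
    ∀ Φ : (N : ℕ) → HardSphereFlow (Torus.geometry (Fin 3)) (hsDiameter σ N) (N + 1),
    ∀ φ : T3 → ℝ, Torus.IsSmooth φ → ∀ δ : ℝ, 0 < δ →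
    ∃ S₀ : ℝ, 0 < S₀ ∧ ∀ S : ℝ, S₀ ≤ S → ∃ N₀ : ℕ, ∀ N : ℕ, N₀ ≤ N →
      ∫⁻ z, ENNReal.ofReal (((S * ((N : ℝ) + 1) ^ (-(1 / 3 : ℝ)))⁻¹ *
          (Φ N).collisionSum (Set.Ioc 0 (S * ((N : ℝ) + 1) ^ (-(1 / 3 : ℝ))))
            (fun c => (φ c.fstPos - φ c.sndPos) * ((‖c.postVel.1‖ ^ 2 - ‖c.preVel.1‖ ^ 2) / 2) / 2) z) ^ 2)
        ∂(localGibbsLaw σ (fun _ => 1) (fun _ => 0) (fun _ => θ) N (Φ N)) ≤ ENNReal.ofReal (δ * ((N : ℝ) + 1))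

/-- **(σ, θ)-UNIFORM shell** that stub 1 actually needs from every equilibrium input (kinetic or collisional): thresholds
uniform over compact boxes, `∀ box ∃ S₀ ∀ S ∃ N₀ ∀ N ∀ (σ, θ) ∈ box`, because `VisibleFluxGibbsianity` quantifies over ALL
diameter sequences with `(M+1) ε_M³ → σ'³` (⇔ `σ'_M := ε_M (M+1)^{1/3} → σ'`) and over temperature boxes; the route's 9583/9584
are typed pointwise (`∃ N₀` per `(σ, θ, S)`), which is the ε-generality gap recorded by lead c4.  Stated for a generic
predicate `P σ θ S N` (e.g. the bodies of the two definitions above, or of `OneBodyCompleteness`). [folklore] -/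
def UniformOverBoxes (P : ℝ → ℝ → ℝ → ℕ → Prop) : Prop :=
  ∃ σ₀ : ℝ, 0 < σ₀ ∧ ∀ (σlo σhi θlo θhi : ℝ), 0 < σlo → σhi < σ₀ → 0 < θlo →
    ∃ S₀ : ℝ, 0 < S₀ ∧ ∀ S : ℝ, S₀ ≤ S → ∃ N₀ : ℕ, ∀ N : ℕ, N₀ ≤ N →
      ∀ σ ∈ Set.Icc σlo σhi, ∀ θ ∈ Set.Icc θlo θhi, P σ θ S N

/-- The uniform shell implies the pointwise one (take the degenerate box `[σ, σ] × [θ, θ]`). [folklore] -/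
theorem pointwise_of_uniformOverBoxes {P : ℝ → ℝ → ℝ → ℕ → Prop} (h : UniformOverBoxes P) :
    ∃ σ₀ : ℝ, 0 < σ₀ ∧ ∀ σ : ℝ, 0 < σ → σ < σ₀ → ∀ θ : ℝ, 0 < θ →
      ∃ S₀ : ℝ, 0 < S₀ ∧ ∀ S : ℝ, S₀ ≤ S → ∃ N₀ : ℕ, ∀ N : ℕ, N₀ ≤ N → P σ θ S N := by
  obtain ⟨σ₀, hσ₀, H⟩ := h
  refine ⟨σ₀, hσ₀, fun σ hσ hσ' θ hθ => ?_⟩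
  obtain ⟨S₀, hS₀, HS⟩ := H σ σ θ θ hσ hσ' hθ
  refine ⟨S₀, hS₀, fun S hS => ?_⟩
  obtain ⟨N₀, HN⟩ := HS S hS
  exact ⟨N₀, fun N hN => HN N hN σ ⟨le_rfl, le_rfl⟩ θ ⟨le_rfl, le_rfl⟩⟩

end Summit.AtomisticToContinuum.HydrodynamicLimit.Theorems.LTEInBand.Stub1Gap

end
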